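import Mathlib.NumberTheory.LegendreSymbol.QuadraticReciprocity
import Mathlib.NumberTheory.LegendreSymbol.QuadraticChar.GaussSum
import HarnessLib

/-!
# The arithmetic of a good dihedral prime: `q ≡ 1 (mod 8)` and `q ≡ 1 (mod s)` for the odd
# primes `s ∣ d` force `d` to be a square modulo `q` (Khare–Wintenberger (I), Def. 2.1 (ii))

Topic `Literature/NumberTheory/Automorphic`; theorems only (no definitions, no named facts).
Khare–Wintenberger, *Serre's modularity conjecture (I)*, Invent. Math. 178 (2009), Def. 2.1
(ii) asks of a good dihedral prime `q` for `ρ̄` that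

> (ii) `q` is `1 mod 8`, and `1 mod r` for every prime `r ≠ q` such that
> `r ≤ max(Q(N(ρ̄)/q²), p)`,

and this is used in the proof of Lemma 6.3 (i) as follows: if the image of `ρ̄` were solvable,
`ρ̄` would be induced from a quadratic field `K`, unramified outside the primes ramified in `ρ̄`
("Note that the primes `s` different from `q` at which `ρ̄` is ramified are such that `q` is
`1 mod s` (and `1 mod 8` if `s = 2`) … Thus the prime `q` either splits in `K` or is ramified in
`K`").  The implicit step — *`q` cannot be inert in `K`* — is the quadratic-reciprocity
computation proved here in its elementary form: for `K = ℚ(√d)` unramified at `q`, the integer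
`d` is supported on `-1`, `2` and odd primes `s` with `q ≡ 1 (mod s)`, and then
`(d/q) = (−1/q)^a (2/q)^b ∏ (s/q) = ∏ (q/s) = ∏ (1/s) = 1` because `q ≡ 1 (mod 8)`, so `q`
splits in `K`.

* `KhareWintenberger.legendreSym_eq_one_of_forall_prime_dvd` — `q` prime, `q ≡ 1 (mod 8)`,
  `n ≥ 1` an integer prime to `q` all of whose odd prime divisors `s` satisfy `q ≡ 1 (mod s)`:
  the Legendre symbol `(n/q)` is `1`.
* `KhareWintenberger.legendreSym_int_eq_one_of_forall_prime_dvd` — the same for a non-zero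
  integer `d` of either sign (`(−1/q) = 1` as `q ≡ 1 (mod 4)`).
* `KhareWintenberger.isSquare_of_forall_prime_dvd` — hence `d` is a square in `ZMod q`, i.e.
  `q` splits in `ℚ(√d)`.

Mathlib supplies quadratic reciprocity (`legendreSym.quadratic_reciprocity_one_mod_four`), the
supplements (`legendreSym.at_two`, `legendreSym.at_neg_one`, `ZMod.χ₈_nat_eq_if_mod_eight`,
`ZMod.χ₄_nat_one_mod_four`) and `legendreSym.eq_one_iff`; nothing is redefined.

## References

* [KhareWintenberger2009] C. Khare, J.-P. Wintenberger, *Serre's modularity conjecture (I)*,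
  Invent. Math. 178 (2009), 485–504: Def. 2.1 (ii) and §6, proof of Lemma 6.3 (i).
-/

namespace Literature.NumberTheory.Automorphic.KhareWintenberger

/-- **`q ≡ 1 (mod 8)` and `q ≡ 1 (mod s)` for every odd prime `s ∣ n` give `(n/q) = 1`**
(`n ≥ 1` prime to the prime `q`).  Induction on `n` along its least prime factor `s`:
`(2/q) = χ₈(q) = 1`; for odd `s`, `(s/q) = (q/s) = (1/s) = 1` by reciprocity (`q ≡ 1 (mod 4)`).
[cite: KhareWintenberger2009, Def. 2.1 (ii) and §6, proof of Lemma 6.3 (i)] -/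
theorem legendreSym_eq_one_of_forall_prime_dvd {q : ℕ} [Fact q.Prime] (hq8 : q % 8 = 1) {n : ℕ}
    (hn : n ≠ 0) (hqn : ¬ q ∣ n) (hs : ∀ s : ℕ, s.Prime → s ∣ n → s ≠ 2 → q % s = 1) :
    legendreSym q n = 1 := by
  induction n using Nat.strong_induction_on with
  | _ n ih =>
    rcases Nat.lt_or_ge 1 n with h1 | h1
    · -- `n > 1`: split off the least prime factor `s`
      have hn1 : n ≠ 1 := by omega
      set s := n.minFac with hs_def
      have hsp : s.Prime := Nat.minFac_prime hn1
      obtain ⟨m, hm⟩ : s ∣ n := Nat.minFac_dvd n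
      have hm0 : m ≠ 0 := by
        rintro rfl
        rw [mul_zero] at hm
        exact hn hm
      have hmlt : m < n := by
        rw [hm]
        exact lt_mul_left (Nat.pos_of_ne_zero hm0) hsp.one_lt
      have hqm : ¬ q ∣ m := fun h => hqn (hm ▸ Dvd.dvd.mul_left h s)
      have hsm : ∀ s' : ℕ, s'.Prime → s' ∣ m → s' ≠ 2 → q % s' = 1 :=
        fun s' hs' hs'm hs'2 => hs s' hs' (hm ▸ Dvd.dvd.mul_left hs'm s) hs'2
      have ihm : legendreSym q m = 1 := ih m hmlt hm0 hqm hsm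
      have hqs : legendreSym q s = 1 := by
        have hq2 : q ≠ 2 := by
          rintro rfl
          norm_num at hq8
        by_cases hs2 : s = 2
        · rw [hs2, Nat.cast_two, legendreSym.at_two hq2, ZMod.χ₈_nat_eq_if_mod_eight]
          have hq2' : q % 2 = 1 := by omega
          simp [hq2', hq8]
        · haveI : Fact s.Prime := ⟨hsp⟩
          have hq4 : q % 4 = 1 := by omega
          have hqs1 : q % s = 1 := hs s hsp ⟨m, hm⟩ hs2
          rw [← legendreSym.quadratic_reciprocity_one_mod_four hq4 hs2, legendreSym.mod,
            show ((q : ℤ) % (s : ℤ)) = 1 by exact_mod_cast hqs1]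
          exact legendreSym.at_one s
      rw [hm, Nat.cast_mul, legendreSym.mul, hqs, ihm, one_mul]
    · -- `n = 1`
      interval_cases n
      · exact absurd rfl hn
      · exact_mod_cast legendreSym.at_one q

/-- The same for an integer `d ≠ 0` of either sign: `(d/q) = 1` (`(−1/q) = χ₄(q) = 1` since
`q ≡ 1 (mod 4)`). [cite: KhareWintenberger2009, Def. 2.1 (ii) and §6, proof of Lemma 6.3 (i)] -/
theorem legendreSym_int_eq_one_of_forall_prime_dvd {q : ℕ} [Fact q.Prime] (hq8 : q % 8 = 1)
    {d : ℤ} (hd : d ≠ 0) (hqd : ¬ (q : ℤ) ∣ d)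
    (hs : ∀ s : ℕ, s.Prime → (s : ℤ) ∣ d → s ≠ 2 → q % s = 1) : legendreSym q d = 1 := by
  have hn : d.natAbs ≠ 0 := Int.natAbs_ne_zero.mpr hd
  have hqn : ¬ q ∣ d.natAbs := fun h => hqd (Int.natCast_dvd.mpr h)
  have hs' : ∀ s : ℕ, s.Prime → s ∣ d.natAbs → s ≠ 2 → q % s = 1 :=
    fun s hsp hsd hs2 => hs s hsp (Int.natCast_dvd.mpr hsd) hs2
  have key := legendreSym_eq_one_of_forall_prime_dvd hq8 hn hqn hs'
  rcases Int.natAbs_eq d with h | h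
  · rw [h]; exact key
  · have hq2 : q ≠ 2 := by
      rintro rfl
      norm_num at hq8
    have hq4 : q % 4 = 1 := by omega
    rw [h, neg_eq_neg_one_mul, legendreSym.mul, key, mul_one, legendreSym.at_neg_one hq2]
    exact ZMod.χ₄_nat_one_mod_four hq4

/-- **A good dihedral prime splits in every admissible quadratic field**: if `q ≡ 1 (mod 8)` and
`q ≡ 1 (mod s)` for every odd prime `s ∣ d` (`d ≠ 0` prime to `q`), then `d` is a square
modulo `q` — so `q` splits in `ℚ(√d)`, the step "the prime `q` either splits in `K` or is
ramified in `K`" of Khare–Wintenberger's proof of Lemma 6.3 (i).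
[cite: KhareWintenberger2009, Def. 2.1 (ii) and §6, proof of Lemma 6.3 (i)] -/
theorem isSquare_of_forall_prime_dvd {q : ℕ} [Fact q.Prime] (hq8 : q % 8 = 1)
    {d : ℤ} (hd : d ≠ 0) (hqd : ¬ (q : ℤ) ∣ d)
    (hs : ∀ s : ℕ, s.Prime → (s : ℤ) ∣ d → s ≠ 2 → q % s = 1) : IsSquare (d : ZMod q) := by
  have hd0 : (d : ZMod q) ≠ 0 := by
    rwa [Ne, ZMod.intCast_zmod_eq_zero_iff_dvd]
  exact (legendreSym.eq_one_iff q hd0).mp (legendreSym_int_eq_one_of_forall_prime_dvd hq8 hd hqd hs)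

end Literature.NumberTheory.Automorphic.KhareWintenberger
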